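import Summits.QuantumFields.YangMills.Theorems.FiniteRankMirrorAssemblyMultiplex
import HarnessLib

/-!
# Route `FiniteRankMirror`, item `Assembly` (stmt-QuantumFields-25641) — CLOSED

`theorem finiteRankMirror_assembly_proof : Summit.QuantumFields.YangMills.Theses.FiniteRankMirror.Assembly`, i.e.
`FiniteRankMirrorFloor → MirrorCrossDecay → MirrorDefectVanishes → SkewAtFiniteRankUnit → BalabanLadder.NT`,
by the two-pass spatial multiplexing of the route's thesis (planner plan `assembly_plan_25641.md`, evidence on the
item): the multiplexed bare mirror floor `multiplex_floor` of `FiniteRankMirrorAssemblyMultiplex` at radius `1`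
discharges the bare-mirror-floor pin of the shared defect item `MirrorDefectVanishes`, which returns a femto radius
`ℓ₃`; multiplexing again inside `B(0, ℓ₃)` gives `V` with `MF_β(V) ≥ 2ε`, and the defect bound with `η = ε` turns
this into clause (i) `ε ≤ Q2_(β,L,a(β))(θV, V)` of `LowerBounds`; clause (ii) is the declared residual
`SkewAtFiniteRankUnit`.  With this file the route's deciding theorem `closes hA h1 h2 h3 h4` is kernel-checked glue.

R3/RECORD framing: route glue only — the cruxes `FiniteRankMirrorFloor` (transmutation wall), `MirrorCrossDecay`,
`MirrorDefectVanishes` and the residual stay OPEN; NT, and a fortiori the Yang–Mills mass gap, are NOT proved here.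
Refs: Fröhlich–Israel–Lieb–Simon 1978 Thm 2.1; Osterwalder–Seiler 1978 §2.
-/

set_option autoImplicit false

noncomputable section

namespace Summit.QuantumFields.YangMills.Theorems

open Summit.QuantumFields.YangMills.Theorems.FiniteRankMirror

/-- **Route `FiniteRankMirror`, item `Assembly` (stmt-QuantumFields-25641):**
`FiniteRankMirrorFloor → MirrorCrossDecay → MirrorDefectVanishes → SkewAtFiniteRankUnit → BalabanLadder.NT`.
Two-pass spatial multiplexing (`multiplex_floor`): PASS 1 at radius `1` produces a bare mirror floor, which is the
pin of `MirrorDefectVanishes` and yields the femto radius `ℓ₃`; PASS 2 at radius `ℓ₃` produces `V` with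
`MF_β(V) ≥ 2ε` eventually, and the defect item with `η = ε` turns it into clause (i) `ε ≤ Q2(θV, V)` of
`LowerBounds`; clause (ii) is the residual `SkewAtFiniteRankUnit`.  R3/RECORD framing: this is route glue — no floor,
ceiling, NT or Yang–Mills mass gap is proved here. [folklore] -/
theorem finiteRankMirror_assembly_proof : Summit.QuantumFields.YangMills.Theses.FiniteRankMirror.Assembly := by
  unfold Summit.QuantumFields.YangMills.Theses.FiniteRankMirror.Assembly
  intro h1 h2 h3 h4 G _ _ _ _ hG
  letI : MeasurableSpace G := borel G
  haveI : BorelSpace G := ⟨rfl⟩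
  obtain ⟨r, a, ha, ha0, hbody⟩ := h1 G hG
  obtain ⟨ℓ₄, C, β₆, Λ₆, hℓ₄, hceil⟩ := h2 G hG r a ha ha0 hbody
  have hii := h4 G hG r a ha ha0 hbody
  obtain ⟨J, p, κ, hp, hκ, hscale⟩ := hbody
  -- PASS 1: a bare mirror floor at radius 1 discharges the pin of the defect item
  obtain ⟨V₀, ε₀, β₀, Λ₀, hV₀, -, hε₀, hM₀⟩ := multiplex_floor G r a ha ha0 hp hκ hscale hℓ₄ hceil 1 one_pos
  obtain ⟨ℓ₃, hℓ₃, hdef⟩ := h3 G hG r a ha ha0 ⟨V₀, ε₀, β₀, Λ₀, hV₀, hε₀, hM₀⟩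
  -- PASS 2: multiplex again inside the defect window
  obtain ⟨V, ε, β₁, Λ₁, hV, hVb, hε, hM⟩ := multiplex_floor G r a ha ha0 hp hκ hscale hℓ₄ hceil ℓ₃ hℓ₃
  obtain ⟨β₇, Λ₇, hD⟩ := hdef V hV hVb (ε / 2) (by positivity)
  have hi : ∃ (v : SchwartzMap (EuclideanSpace ℝ (Fin 4)) ℝ) (ε β₅ Λ₅ : ℝ),
      tsupport (v : EuclideanSpace ℝ (Fin 4) → ℝ) ⊆ {y : EuclideanSpace ℝ (Fin 4) | 0 < y 0} ∧ 0 < ε ∧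
      ∀ β : ℝ, β₅ ≤ β → ∀ L : ℕ, Λ₅ ≤ a β * L →
        ε ≤ Cruxes.OSLegsFromFemtoAndGap.DlrCollarTransfer.Q2 G r β L (a β)
          (Literature.MathematicalPhysics.QuantumLattice.thetaTest 4 v) v := by
    refine ⟨V, ε / 2, max β₁ β₇, max Λ₁ Λ₇, hV, by positivity, ?_⟩
    intro β hβ L hL
    have h1' := hM β ((le_max_left _ _).trans hβ) L ((le_max_left _ _).trans hL)
    have h2' := hD β ((le_max_right _ _).trans hβ) L ((le_max_right _ _).trans hL)
    rw [abs_le] at h2'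
    linarith [h2'.1, h2'.2]
  exact ⟨r, a, ha, ha0, And.intro hi hii⟩

end Summit.QuantumFields.YangMills.Theorems

end
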